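import Literature.MathematicalPhysics.QuantumFieldTheory.Balaban1983to89.B7Prop2Explicit
import Literature.MathematicalPhysics.QuantumFieldTheory.Balaban1983to89.B7Prop3Flat
import HarnessLib

/-!
# Route `UnitScaleTilt`, crux K1 «MinimiserStabilityRegPr» (stmt-QuantumFields-19200), route-R E′ path (α′), (E1) — **THE E1-SIDE L-ONLY WINDOWS HOLD FOR EVERY SMALL `e₆ > 0`**
# (an `∀ᶠ e₆ in 𝓝[>] 0` certificate, composable by `Filter.Eventually.and` with the other sides' windows): the regime inequalities displayed by
# ✓ `Prop7DatumOfThm2S.hDatum_of_thm2S_member` (Prop. 2 ∕ (1.72) windows), by the (E1)-door ✓ `Prop7PinnedSliceRowOfThm2Datum.pinnedSliceRow_of_thm2Datum` (datum windows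
# `s₀ ≤ 1∕64`, `σ ≤ 1∕1024`, `(6+2c₀)(2σ) ≤ 1∕256`; chart size `40s ≤ L`; contraction windows `1800Cs ≤ 1`, `(3C∕2)·1600·(7(3C∕2)s + s) ≤ 1∕2`) at the constants
# `s₀ := 2B₁′e₆`, `s₁′ := 6B₁′e₆`, `σ := 240B₁′e₆`, `c₀ = c₁ := c35a₅e^{c35a₅}`, `s := S₁ + S₂`, ALL hold eventually as `e₆ → 0⁺`

Cell `ym3-torus`, width seat `ym3-torus-px13` (gen 4).  THEOREMS ONLY (0 `def`, 0 `sorry`, 0 `instance`); `--supports stmt-QuantumFields-19200`, count-neutral.  YM₃ on T³ is a ladder rung (R3), not the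
Clay problem; nothing here claims the stub, the crux, d = 4 or the gap.  Pure real analysis (continuity at `0`); no estimate of Bałaban's.

WHAT IS PROVED (ns `…Theorems.Prop7E1WindowsEventually`).
* `eventually_le_of_lt_at_zero` — `f` continuous, `f 0 < b` ⟹ `∀ᶠ e in 𝓝[>] 0, f e ≤ b`.
* ★★ `eventually_E1_windows` — for `c₁′ > 0`, `L ≥ 1`, any reals `B₁′ C c35 a₅` (so `c2′ 3 L, c3 3 L > 0`): `∀ᶠ e₆ in 𝓝[>] 0`, the twelve E1-side windows hold, with the chart size
  `s := S₁(s₀,σ,c₀) + S₂(s₁′,σ,c₀,c₁)` written out (`S₁ S₂` = w1's printed constants of ✓ `exists_untwistedStart_En_T3`, `d = 3`) — so `hS₁ : S₁ ≤ s`, `hS₂ : S₂ ≤ s` hold by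
  nonnegativity (`S₁_nonneg`, `S₂_nonneg`), and `0 < e₆` rides along.
HONEST SCOPE.  Window bookkeeping for the assembler; the growth side's and E′'s own windows (`sQ`, `ζ`, `δ₁`) are not touched.

References: T. Bałaban, CMP 102 (1985) 277–309 [Balaban1985Variational] (Prop. 7 p.299); CMP 98 (1985) 17–51 [Balaban1985Averaging] (Prop. 2 p.26); CMP 99 (1985) 75–102
[Balaban1985RegularSpaces] ((1.72) p.88).
-/

set_option autoImplicit false

noncomputable section

open Filter Topology

namespace Summit.QuantumFields.YangMills.Theorems.Prop7E1WindowsEventually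

open Literature.MathematicalPhysics.QuantumFieldTheory.Balaban1983to89
open B7Prop2Explicit (C0 c2' C0_pos c2'_pos)
open B7Prop3Flat (c3)

/-- A continuous real function strictly below `b` at `0` stays `≤ b` for all small `e > 0`. [folklore] -/
theorem eventually_le_of_lt_at_zero {f : ℝ → ℝ} {b : ℝ} (hf : Continuous f) (h0 : f 0 < b) : ∀ᶠ e in 𝓝[>] (0 : ℝ), f e ≤ b := by
  have h : ∀ᶠ e in 𝓝 (0 : ℝ), f e < b := hf.continuousAt.eventually_lt continuousAt_const h0
  exact (h.filter_mono nhdsWithin_le_nhds).mono fun _ hx => hx.le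

/-- `c3 3 L > 0` for `L ≥ 1` (`c3 d L = 1∕(128(d+1)L)`). [cite: Balaban1985Averaging, (106) p.33 (constant)] -/
theorem c3_pos {L : ℕ} (hL : 1 ≤ L) : 0 < c3 3 L := by
  unfold c3
  have : (0 : ℝ) < L := by exact_mod_cast hL
  positivity

/-- `S₁(s₀,σ,c₀) ≥ 0` for nonnegative letters. [folklore] -/
theorem S₁_nonneg {s₀ σ c₀ : ℝ} (hs₀ : 0 ≤ s₀) (hσ : 0 ≤ σ) (hc₀ : 0 ≤ c₀) : 0 ≤ s₀ + (1 + 2 * s₀) * ((1 + 6 * σ) * ((6 + 2 * c₀) * (2 * σ))) := by positivity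

/-- `S₂(s₁′,σ,c₀,c₁; d = 3) ≥ 0` for nonnegative letters. [folklore] -/
theorem S₂_nonneg {s₀ s₁' σ c₀ c₁ : ℝ} (hs₀ : 0 ≤ s₀) (hs₁ : 0 ≤ s₁') (hσ : 0 ≤ σ) (hc₀ : 0 ≤ c₀) (hc₁ : 0 ≤ c₁) :
    0 ≤ s₁' + (3 : ℝ) * (((2 * (c₁ + 2 * c₀ ^ 2) + 24 * c₀ + 24) * (2 * σ)) + 9 * ((6 + 2 * c₀) * (2 * σ)) ^ 2 + 36 * σ * ((2 * (c₁ + 2 * c₀ ^ 2) + 24 * c₀ + 24) * (2 * σ)))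
      + (3 : ℝ) * (6 * ((6 + 2 * c₀) * (2 * σ)) * s₀ + 4 * s₀ * ((1 + 6 * σ) * ((6 + 2 * c₀) * (2 * σ)))) := by positivity

/-- ★★ **THE E1-SIDE WINDOWS, EVENTUALLY AS `e₆ → 0⁺`.**  With `s₀ := 2B₁′e₆`, `s₁′ := 6B₁′e₆`, `σ := 240B₁′e₆`, `c₀ = c₁ := c35a₅e^{c35a₅}` and the chart size `s := S₁ + S₂` (written out),
every small `e₆ > 0` satisfies: the COV window `2e₆ ≤ c₁′`; the Prop. 2 ∕ (1.72) windows of ✓ `hDatum_of_thm2S_member`; the door's datum windows; `40s ≤ L`; the contraction windows at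
constant `C`. [cite: Balaban1985Variational, Prop. 7 p.299; Balaban1985Averaging, Prop. 2 p.26; Balaban1985RegularSpaces, (1.72) p.88] -/
theorem eventually_E1_windows (L : ℕ) (hL : 1 ≤ L) (B₁' C c35 a₅ : ℝ) {c₁' : ℝ} (hc₁' : 0 < c₁') :
    ∀ᶠ e₆ in 𝓝[>] (0 : ℝ), 0 < e₆ ∧
      -- COV ∕ Prop. 2 ∕ (1.72) windows (✓ `hDatum_of_thm2S_member`)
      2 * e₆ ≤ c₁' ∧ C0 3 * (2 * e₆) ≤ 1 / 3 ∧ 8 * e₆ ≤ c2' 3 L ∧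
      Real.exp (4 * (800 * ((3 : ℝ) + 1) ^ 2 * ((3 : ℝ) + 4)) * (2 * e₆)) * (1 + 8 * (131072 * ((3 : ℝ) + 1) ^ 2) * (2 * B₁' * e₆)) ≤ 2 ∧
      2 * (2 * B₁' * e₆) ≤ c3 3 L ∧ 128 * (3 : ℝ) * (2 * B₁' * e₆) ≤ 1 ∧
      -- the door's datum windows at `s₀ := 2B₁′e₆`, `σ := 240B₁′e₆`, `c₀ := c35a₅e^{c35a₅}`
      2 * B₁' * e₆ ≤ 1 / 64 ∧ 240 * B₁' * e₆ ≤ 1 / 1024 ∧ (6 + 2 * (c35 * a₅ * Real.exp (c35 * a₅))) * (2 * (240 * B₁' * e₆)) ≤ 1 / 256 ∧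
      -- chart size `s := S₁ + S₂` (`s₁′ := 6B₁′e₆`, `c₁ := c₀`): `40s ≤ L` and the contraction windows at constant `C`
      40 * ((2 * B₁' * e₆ + (1 + 2 * (2 * B₁' * e₆)) * ((1 + 6 * (240 * B₁' * e₆)) * ((6 + 2 * (c35 * a₅ * Real.exp (c35 * a₅))) * (2 * (240 * B₁' * e₆)))))
        + (6 * B₁' * e₆ + (3 : ℝ) * (((2 * ((c35 * a₅ * Real.exp (c35 * a₅)) + 2 * (c35 * a₅ * Real.exp (c35 * a₅)) ^ 2) + 24 * (c35 * a₅ * Real.exp (c35 * a₅)) + 24) * (2 * (240 * B₁' * e₆)))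
            + 9 * ((6 + 2 * (c35 * a₅ * Real.exp (c35 * a₅))) * (2 * (240 * B₁' * e₆))) ^ 2
            + 36 * (240 * B₁' * e₆) * ((2 * ((c35 * a₅ * Real.exp (c35 * a₅)) + 2 * (c35 * a₅ * Real.exp (c35 * a₅)) ^ 2) + 24 * (c35 * a₅ * Real.exp (c35 * a₅)) + 24) * (2 * (240 * B₁' * e₆))))
          + (3 : ℝ) * (6 * ((6 + 2 * (c35 * a₅ * Real.exp (c35 * a₅))) * (2 * (240 * B₁' * e₆))) * (2 * B₁' * e₆)
            + 4 * (2 * B₁' * e₆) * ((1 + 6 * (240 * B₁' * e₆)) * ((6 + 2 * (c35 * a₅ * Real.exp (c35 * a₅))) * (2 * (240 * B₁' * e₆))))))) ≤ (L : ℝ) ∧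
      1800 * C * ((2 * B₁' * e₆ + (1 + 2 * (2 * B₁' * e₆)) * ((1 + 6 * (240 * B₁' * e₆)) * ((6 + 2 * (c35 * a₅ * Real.exp (c35 * a₅))) * (2 * (240 * B₁' * e₆)))))
        + (6 * B₁' * e₆ + (3 : ℝ) * (((2 * ((c35 * a₅ * Real.exp (c35 * a₅)) + 2 * (c35 * a₅ * Real.exp (c35 * a₅)) ^ 2) + 24 * (c35 * a₅ * Real.exp (c35 * a₅)) + 24) * (2 * (240 * B₁' * e₆)))
            + 9 * ((6 + 2 * (c35 * a₅ * Real.exp (c35 * a₅))) * (2 * (240 * B₁' * e₆))) ^ 2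
            + 36 * (240 * B₁' * e₆) * ((2 * ((c35 * a₅ * Real.exp (c35 * a₅)) + 2 * (c35 * a₅ * Real.exp (c35 * a₅)) ^ 2) + 24 * (c35 * a₅ * Real.exp (c35 * a₅)) + 24) * (2 * (240 * B₁' * e₆))))
          + (3 : ℝ) * (6 * ((6 + 2 * (c35 * a₅ * Real.exp (c35 * a₅))) * (2 * (240 * B₁' * e₆))) * (2 * B₁' * e₆)
            + 4 * (2 * B₁' * e₆) * ((1 + 6 * (240 * B₁' * e₆)) * ((6 + 2 * (c35 * a₅ * Real.exp (c35 * a₅))) * (2 * (240 * B₁' * e₆))))))) ≤ 1 ∧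
      3 / 2 * C * (400 * (1 + 3)) * (7 * (3 / 2 * C) *
          ((2 * B₁' * e₆ + (1 + 2 * (2 * B₁' * e₆)) * ((1 + 6 * (240 * B₁' * e₆)) * ((6 + 2 * (c35 * a₅ * Real.exp (c35 * a₅))) * (2 * (240 * B₁' * e₆)))))
        + (6 * B₁' * e₆ + (3 : ℝ) * (((2 * ((c35 * a₅ * Real.exp (c35 * a₅)) + 2 * (c35 * a₅ * Real.exp (c35 * a₅)) ^ 2) + 24 * (c35 * a₅ * Real.exp (c35 * a₅)) + 24) * (2 * (240 * B₁' * e₆)))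
            + 9 * ((6 + 2 * (c35 * a₅ * Real.exp (c35 * a₅))) * (2 * (240 * B₁' * e₆))) ^ 2
            + 36 * (240 * B₁' * e₆) * ((2 * ((c35 * a₅ * Real.exp (c35 * a₅)) + 2 * (c35 * a₅ * Real.exp (c35 * a₅)) ^ 2) + 24 * (c35 * a₅ * Real.exp (c35 * a₅)) + 24) * (2 * (240 * B₁' * e₆))))
          + (3 : ℝ) * (6 * ((6 + 2 * (c35 * a₅ * Real.exp (c35 * a₅))) * (2 * (240 * B₁' * e₆))) * (2 * B₁' * e₆)
            + 4 * (2 * B₁' * e₆) * ((1 + 6 * (240 * B₁' * e₆)) * ((6 + 2 * (c35 * a₅ * Real.exp (c35 * a₅))) * (2 * (240 * B₁' * e₆)))))))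
        + ((2 * B₁' * e₆ + (1 + 2 * (2 * B₁' * e₆)) * ((1 + 6 * (240 * B₁' * e₆)) * ((6 + 2 * (c35 * a₅ * Real.exp (c35 * a₅))) * (2 * (240 * B₁' * e₆)))))
        + (6 * B₁' * e₆ + (3 : ℝ) * (((2 * ((c35 * a₅ * Real.exp (c35 * a₅)) + 2 * (c35 * a₅ * Real.exp (c35 * a₅)) ^ 2) + 24 * (c35 * a₅ * Real.exp (c35 * a₅)) + 24) * (2 * (240 * B₁' * e₆)))
            + 9 * ((6 + 2 * (c35 * a₅ * Real.exp (c35 * a₅))) * (2 * (240 * B₁' * e₆))) ^ 2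
            + 36 * (240 * B₁' * e₆) * ((2 * ((c35 * a₅ * Real.exp (c35 * a₅)) + 2 * (c35 * a₅ * Real.exp (c35 * a₅)) ^ 2) + 24 * (c35 * a₅ * Real.exp (c35 * a₅)) + 24) * (2 * (240 * B₁' * e₆))))
          + (3 : ℝ) * (6 * ((6 + 2 * (c35 * a₅ * Real.exp (c35 * a₅))) * (2 * (240 * B₁' * e₆))) * (2 * B₁' * e₆)
            + 4 * (2 * B₁' * e₆) * ((1 + 6 * (240 * B₁' * e₆)) * ((6 + 2 * (c35 * a₅ * Real.exp (c35 * a₅))) * (2 * (240 * B₁' * e₆)))))))) ≤ 1 / 2 := by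
  have hc2 : 0 < c2' 3 L := c2'_pos 3 L hL
  have hc3 : 0 < c3 3 L := c3_pos hL
  have hC0 : 0 < C0 3 := C0_pos 3
  have hLr : (0 : ℝ) < (L : ℝ) := by exact_mod_cast hL
  have hpos : ∀ᶠ e₆ in 𝓝[>] (0 : ℝ), 0 < e₆ := eventually_mem_nhdsWithin
  -- each window is `f e₆ ≤ b` with `f` continuous and `f 0 < b`
  refine hpos.and ?_
  refine (eventually_le_of_lt_at_zero (by fun_prop) (by norm_num; assumption)).and ?_
  refine (eventually_le_of_lt_at_zero (by fun_prop) (by norm_num)).and ?_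
  refine (eventually_le_of_lt_at_zero (by fun_prop) (by norm_num; assumption)).and ?_
  refine (eventually_le_of_lt_at_zero (by fun_prop) (by norm_num)).and ?_
  refine (eventually_le_of_lt_at_zero (by fun_prop) (by norm_num; assumption)).and ?_
  refine (eventually_le_of_lt_at_zero (by fun_prop) (by norm_num)).and ?_
  refine (eventually_le_of_lt_at_zero (by fun_prop) (by norm_num)).and ?_
  refine (eventually_le_of_lt_at_zero (by fun_prop) (by norm_num)).and ?_
  refine (eventually_le_of_lt_at_zero (by fun_prop) (by norm_num)).and ?_
  refine (eventually_le_of_lt_at_zero (by fun_prop) (by norm_num; assumption)).and ?_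
  refine (eventually_le_of_lt_at_zero (by fun_prop) (by norm_num)).and ?_
  exact eventually_le_of_lt_at_zero (by fun_prop) (by norm_num)

end Summit.QuantumFields.YangMills.Theorems.Prop7E1WindowsEventually

end
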